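import Summits.QuantumFields.YangMills.Theorems.UniversalDetectorHankelMirror
import Summits.QuantumFields.YangMills.Theorems.BalabanLadderNTCumulantPolarisationDefs
import HarnessLib

/-!
# Route `UniversalDetector`, LINE g10-3 «transverse curvature» — the transverse step of a plane kernel is a mirror
pairing with a DIFFERENCE observable

Ideator seat ym-idea-8 (generation 10, lens «dual»); toolkit for the support item `UniversalDetector.CurvatureEdgeGlue`
(stmt-QuantumFields-24088) of rung R2a (`BalabanLadder.NT`).  Route-independent lattice facts, valid for EVERY compact
`G`, every lattice representation `r`, every `β ≥ 0` and every odd torus `2L+1`: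

* `curvDefect` — the TRANSVERSE CONCAVITY DEFECT of the diagonal time-axis kernel of species `q` across a spatial
  vector `v` (`v₀ = 0`) at time lag `t`:  `Δ_q^v(t) = 2·D_q(t) − Cov_T(P_q 0, P_q(t e₀ + v)) − Cov_T(P_q 0, P_q(t e₀ − v))`;
* `sq_cov_plane_tstep_le` — **the transverse step inequality**: for species `p, q`, a site `z` with `z₀ ≥ 1` split as
  `z₀ = s + δ_p + y₀` (`s, y₀ ≥ 0`, both `+2 ≤ L`) and a spatial vector `v`,
  `(Cov_T(P_p 0, P_q z) − Cov_T(P_p 0, P_q(z + v)))² ≤ D_p(2s + δ_p) · Δ_q^v(2y₀ + δ_q)`.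
  It is the two-observable reflection-positivity Cauchy–Schwarz inequality `sq_mirrorCov_le` for `F = P_p(s e₀)` and
  the difference observable `H = P_q(y) − P_q(y + v)`: the mirror pairing of `F` and `H` is the transverse step (the
  reflected plaquette sits at `reflSite p (s e₀) = −(s+δ_p) e₀`), the mirror form of `F` is a diagonal kernel value,
  and the mirror form of `H` is the concavity defect, because the site mirror commutes with spatial translations
  (`reflSite_add_of_apply_zero`).

So a CEILING on the diagonal kernels at far lags (`O(a⁸)`) and an `O(a¹⁰)` bound on the defect at far axis lags bound
every transverse unit step of every plane kernel by `O(a⁹)` — the mechanism of `CurvatureEdgeGlue` (file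
`UniversalDetectorCurvatureEdgeGlue`).  HONEST FRAMING: lattice identities and one inequality; no continuum statement,
no summit, rung or crux is proved here; not Clay.  Refs: Fröhlich–Israel–Lieb–Simon, Comm. Math. Phys. 62 (1978)
Thm. 2.1 (RP Cauchy–Schwarz); Osterwalder–Seiler, Ann. Phys. 110 (1978) §2 (site mirror of Wilson plaquettes).
-/

set_option autoImplicit false

noncomputable section

open MeasureTheory Filter Topology
open Literature.MathematicalPhysics.QuantumFieldTheory Literature.MathematicalPhysics.QuantumLattice
  Literature.Probability.LatticeModels
open Summit.QuantumFields.YangMills.Cruxes.OSLegsFromFemtoAndGap.DlrCollarTransfer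
open Summit.QuantumFields.YangMills.Cruxes.UniversalDetectorPlaneTight (cov_plane_translate)
open Summit.QuantumFields.YangMills.Theorems.InfVolRP (reflSite reflSite_apply_zero reflSite_apply_of_ne
  plane_cfgReflect)
open Summit.QuantumFields.YangMills.Cruxes.NT.MarkovMirror (torusE_add)
open Summit.QuantumFields.YangMills.Cruxes.NT.CumulantPolarisation (torusE_sub)
open Summit.QuantumFields.YangMills.Theorems.MirrorDomination (torusE_plane_site)

namespace Summit.QuantumFields.YangMills.Cruxes.UniversalDetectorHankel

variable (G : Type) [Group G] [TopologicalSpace G] [IsTopologicalGroup G] [CompactSpace G]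
  [MeasurableSpace G] [BorelSpace G] (r : LatticeRep G)

/-! ## §15 The site mirror commutes with spatial translations -/

omit [Group G] [TopologicalSpace G] [IsTopologicalGroup G] [CompactSpace G] [MeasurableSpace G] [BorelSpace G] in
/-- `reflSite q (y + v) = reflSite q y + v` for a spatial vector `v` (`v₀ = 0`). [folklore] -/
theorem reflSite_add_of_apply_zero (q : Fin 4 × Fin 4) (y v : Site 4) (hv : v 0 = 0) :
    reflSite q (y + v) = reflSite q y + v := by
  funext k
  by_cases hk : k = 0
  · subst hk
    rw [Pi.add_apply, reflSite_apply_zero, reflSite_apply_zero, Pi.add_apply, hv]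
    ring
  · rw [Pi.add_apply, reflSite_apply_of_ne q _ hk, reflSite_apply_of_ne q _ hk, Pi.add_apply]

/-! ## §16 The difference observable `H = P_q(y) − P_q(y+v)` -/

omit [IsTopologicalGroup G] [CompactSpace G] [BorelSpace G] in
/-- The difference of two plane fields is a cylinder observable on the union of their supports. [folklore] -/
theorem diffObs_isCylinder (q : Fin 4 × Fin 4) (y v : Site 4) :
    IsCylinder (fun V => plane G r q y V - plane G r q (y + v) V)
      ((originPlaquetteSupport q.1 q.2).image (fun e => (e.1 - -y, e.2)) ∪
        (originPlaquetteSupport q.1 q.2).image (fun e => (e.1 - -(y + v), e.2))) := by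
  intro U V h
  show plane G r q y U - plane G r q (y + v) U = plane G r q y V - plane G r q (y + v) V
  rw [isCylinder_plane r q y (fun e he => h e (Finset.mem_coe.2 (Finset.mem_union_left _ (Finset.mem_coe.1 he)))),
    isCylinder_plane r q (y + v)
      (fun e he => h e (Finset.mem_coe.2 (Finset.mem_union_right _ (Finset.mem_coe.1 he))))]

omit [Group G] [TopologicalSpace G] [IsTopologicalGroup G] [CompactSpace G] [MeasurableSpace G] [BorelSpace G] in
/-- Window of the difference observable: with `0 ≤ y₀`, `y₀ + 2 ≤ L` and `v₀ = 0` all its links are based at times in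
`[0, L−1]`. [folklore] -/
theorem diffObs_window (q : Fin 4 × Fin 4) (y v : Site 4) (hv : v 0 = 0) {L : ℕ} (h0 : 0 ≤ y 0)
    (h2 : y 0 + 2 ≤ (L : ℤ)) :
    ∀ e ∈ (originPlaquetteSupport q.1 q.2).image (fun e => (e.1 - -y, e.2)) ∪
        (originPlaquetteSupport q.1 q.2).image (fun e => (e.1 - -(y + v), e.2)), 0 ≤ e.1 0 ∧ e.1 0 + 1 ≤ (L : ℤ) := by
  have hyv : (y + v) 0 = y 0 := by rw [Pi.add_apply, hv, add_zero]
  intro e he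
  rcases Finset.mem_union.1 he with he | he
  · exact supp_plane_timeWindow q y h0 h2 e he
  · exact supp_plane_timeWindow q (y + v) (by rw [hyv]; exact h0) (by rw [hyv]; exact h2) e he

/-! ## §17 The transverse concavity defect -/

/-- The TRANSVERSE CONCAVITY DEFECT of the diagonal kernel of species `q` across the spatial vector `v` at time lag `t`:
`Δ_q^v(t) = 2·D_q(t) − Cov_T(P_q 0, P_q(t e₀ + v)) − Cov_T(P_q 0, P_q(t e₀ − v))` (unnormalised). -/
def curvDefect (β : ℝ) (L : ℕ) (q : Fin 4 × Fin 4) (v : Site 4) (t : ℤ) : ℝ :=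
  2 * diagCov G r β L q t -
    (torusE G r β L (fun V => plane G r q 0 V * plane G r q (Pi.single 0 t + v) V) -
      torusE G r β L (plane G r q 0) * torusE G r β L (plane G r q (Pi.single 0 t + v))) -
    (torusE G r β L (fun V => plane G r q 0 V * plane G r q (Pi.single 0 t - v) V) -
      torusE G r β L (plane G r q 0) * torusE G r β L (plane G r q (Pi.single 0 t - v)))

/-! ## §18 The transverse step inequality -/

set_option maxHeartbeats 800000 in
/-- **Transverse step inequality.**  For `β ≥ 0`, `L ≥ 1`, species `p, q`, a site `z`, a spatial vector `v`
(`v₀ = 0`) and a split `s : ℕ` with `0 ≤ z₀ − s − δ_p`, `s + 2 ≤ L`, `z₀ − s − δ_p + 2 ≤ L`: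
`(Cov_T(P_p 0, P_q z) − Cov_T(P_p 0, P_q(z+v)))² ≤ D_p(2s + δ_p) · Δ_q^v(2(z₀ − s − δ_p) + δ_q)` — reflection-positivity
Cauchy–Schwarz for `F = P_p(s e₀)` and the difference observable `H = P_q(y) − P_q(y+v)`, `y = z − (s+δ_p)e₀`.
[cite: FrohlichIsraelLiebSimon1978, Thm. 2.1] -/
theorem sq_cov_plane_tstep_le {β : ℝ} (hβ : 0 ≤ β) {L : ℕ} (hL : 1 ≤ L) {p q : Fin 4 × Fin 4} (hp : p.1 < p.2)
    (hq : q.1 < q.2) (z v : Site 4) (hv : v 0 = 0) (s : ℕ) (hy0 : 0 ≤ z 0 - s - elec p) (hs2 : (s : ℤ) + 2 ≤ L)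
    (hy2 : z 0 - s - elec p + 2 ≤ L) :
    ((torusE G r β L (fun V => plane G r p 0 V * plane G r q z V) -
          torusE G r β L (plane G r p 0) * torusE G r β L (plane G r q z)) -
        (torusE G r β L (fun V => plane G r p 0 V * plane G r q (z + v) V) -
          torusE G r β L (plane G r p 0) * torusE G r β L (plane G r q (z + v)))) ^ 2 ≤
      diagCov G r β L p (2 * s + elec p) * curvDefect G r β L q v (2 * (z 0 - s - elec p) + elec q) := by
  obtain ⟨K, hK⟩ := exists_abs_plane_le r
  set x : Site 4 := Pi.single 0 (s : ℤ) with hx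
  set y : Site 4 := z - Pi.single 0 ((s : ℤ) + elec p) with hy
  have hx0 : x 0 = s := by simp [hx]
  have hy0' : y 0 = z 0 - s - elec p := by simp [hy]; ring
  -- the difference observable is a bounded continuous cylinder in the window
  have cC : Continuous fun V => plane G r q y V := continuous_plane r q y
  have cD : Continuous fun V => plane G r q (y + v) V := continuous_plane r q (y + v)
  have hHc : Continuous fun V => plane G r q y V - plane G r q (y + v) V := cC.sub cD
  have hHb : ∀ U, |plane G r q y U - plane G r q (y + v) U| ≤ K + K := fun U =>
    (abs_sub _ _).trans (add_le_add (hK q y U) (hK q (y + v) U))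
  have key := sq_mirrorCov_le G r hβ hL (continuous_plane r p x) hHc (hK p x) hHb (isCylinder_plane r p x)
    (diffObs_isCylinder G r q y v)
    (supp_plane_timeWindow p x (by rw [hx0]; exact_mod_cast Nat.zero_le s) (by rw [hx0]; exact hs2))
    (diffObs_window q y v hv (by rw [hy0']; exact hy0) (by rw [hy0']; exact hy2))
  -- the reflected sites
  have hrx : reflSite p x = -Pi.single 0 ((s : ℤ) + elec p) := by rw [hx]; exact reflSite_single p s
  have hryv : reflSite q (y + v) = reflSite q y + v := reflSite_add_of_apply_zero q y v hv
  have hzy : y - reflSite p x = z := by rw [hrx, hy, sub_neg_eq_add, sub_add_cancel]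
  have hzvy : y + v - reflSite p x = z + v := by rw [add_sub_right_comm, hzy]
  -- site-independence of the plaquette means
  have mpx : torusE G r β L (plane G r p x) = torusE G r β L (plane G r p 0) := torusE_plane_site G r β L p x 0
  have mprx : torusE G r β L (plane G r p (reflSite p x)) = torusE G r β L (plane G r p 0) :=
    torusE_plane_site G r β L p _ 0
  have mq : ∀ w : Site 4, torusE G r β L (plane G r q w) = torusE G r β L (plane G r q 0) := fun w =>
    torusE_plane_site G r β L q w 0
  -- continuity of the fields and products that are expanded
  have cA : Continuous fun V => plane G r p (reflSite p x) V := continuous_plane r p _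
  have cB : Continuous fun V => plane G r q (reflSite q y) V := continuous_plane r q _
  have cB' : Continuous fun V => plane G r q (reflSite q y + v) V := continuous_plane r q _
  have cAC : Continuous fun V => plane G r p (reflSite p x) V * plane G r q y V := cA.mul cC
  have cAD : Continuous fun V => plane G r p (reflSite p x) V * plane G r q (y + v) V := cA.mul cD
  have cBC : Continuous fun V => plane G r q (reflSite q y) V * plane G r q y V := cB.mul cC
  have cB'D : Continuous fun V => plane G r q (reflSite q y + v) V * plane G r q (y + v) V := cB'.mul cD
  have cBD : Continuous fun V => plane G r q (reflSite q y) V * plane G r q (y + v) V := cB.mul cD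
  have cB'C : Continuous fun V => plane G r q (reflSite q y + v) V * plane G r q y V := cB'.mul cC
  have cS1 : Continuous fun V => plane G r q (reflSite q y) V * plane G r q y V +
      plane G r q (reflSite q y + v) V * plane G r q (y + v) V := cBC.add cB'D
  have cS2 : Continuous fun V => plane G r q (reflSite q y) V * plane G r q (y + v) V +
      plane G r q (reflSite q y + v) V * plane G r q y V := cBD.add cB'C
  -- (1) the mirror pairing of `F` and `H` is the transverse step
  have e1 : torusE G r β L (fun V => plane G r p x (cfgReflect V) * (plane G r q y V - plane G r q (y + v) V)) -
      torusE G r β L (plane G r p x) * torusE G r β L (fun V => plane G r q y V - plane G r q (y + v) V) =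
      (torusE G r β L (fun V => plane G r p 0 V * plane G r q z V) -
          torusE G r β L (plane G r p 0) * torusE G r β L (plane G r q z)) -
        (torusE G r β L (fun V => plane G r p 0 V * plane G r q (z + v) V) -
          torusE G r β L (plane G r p 0) * torusE G r β L (plane G r q (z + v))) := by
    simp only [plane_cfgReflect r hp]
    have hsplit : (fun V => plane G r p (reflSite p x) V * (plane G r q y V - plane G r q (y + v) V)) =
        fun V => plane G r p (reflSite p x) V * plane G r q y V - plane G r p (reflSite p x) V * plane G r q (y + v) V := by
      funext V; ring
    rw [hsplit, torusE_sub G r β L cAC cAD, torusE_sub G r β L cC cD]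
    have t1 := cov_plane_translate r β L p q (reflSite p x) y
    have t2 := cov_plane_translate r β L p q (reflSite p x) (y + v)
    rw [hzy] at t1
    rw [hzvy] at t2
    rw [mprx, mq y, mq z] at t1
    rw [mprx, mq (y + v), mq (z + v)] at t2
    rw [mpx, mq y, mq (y + v), mq z, mq (z + v)]
    linarith
  -- (2) the mirror form of `F` is a diagonal kernel value
  have e2 : torusE G r β L (fun V => plane G r p x (cfgReflect V) * plane G r p x V) - torusE G r β L (plane G r p x) ^ 2 =
      diagCov G r β L p (2 * s + elec p) := by
    simp only [plane_cfgReflect r hp]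
    rw [sq]
    nth_rewrite 1 [torusE_plane_site G r β L p x (reflSite p x)]
    rw [cov_plane_translate r β L p p (reflSite p x) x, sub_reflSite, hx0]
    rfl
  -- (3) the mirror form of `H` is the concavity defect
  have e3 : torusE G r β L (fun V => (plane G r q y (cfgReflect V) - plane G r q (y + v) (cfgReflect V)) *
        (plane G r q y V - plane G r q (y + v) V)) -
      torusE G r β L (fun V => plane G r q y V - plane G r q (y + v) V) ^ 2 =
      curvDefect G r β L q v (2 * (z 0 - s - elec p) + elec q) := by
    simp only [plane_cfgReflect r hq, hryv]
    have hsplit : (fun V => (plane G r q (reflSite q y) V - plane G r q (reflSite q y + v) V) *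
          (plane G r q y V - plane G r q (y + v) V)) =
        fun V => (plane G r q (reflSite q y) V * plane G r q y V + plane G r q (reflSite q y + v) V * plane G r q (y + v) V) -
          (plane G r q (reflSite q y) V * plane G r q (y + v) V + plane G r q (reflSite q y + v) V * plane G r q y V) := by
      funext V; ring
    rw [hsplit, torusE_sub G r β L cS1 cS2, torusE_add G r β L cBC cB'D, torusE_add G r β L cBD cB'C,
      torusE_sub G r β L cC cD]
    -- the four product expectations as translated covariances
    have hyr : y - reflSite q y = Pi.single 0 (2 * (z 0 - s - elec p) + elec q) := by rw [sub_reflSite, hy0']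
    have t1 := cov_plane_translate r β L q q (reflSite q y) y
    have t2 := cov_plane_translate r β L q q (reflSite q y + v) (y + v)
    have t3 := cov_plane_translate r β L q q (reflSite q y) (y + v)
    have t4 := cov_plane_translate r β L q q (reflSite q y + v) y
    rw [hyr] at t1
    rw [add_sub_add_right_eq_sub, hyr] at t2
    rw [show y + v - reflSite q y = y - reflSite q y + v by abel, hyr] at t3
    rw [show y - (reflSite q y + v) = y - reflSite q y - v by abel, hyr] at t4
    rw [mq (reflSite q y), mq (Pi.single 0 _)] at t1
    rw [mq (reflSite q y + v), mq (Pi.single 0 _)] at t2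
    rw [mq (reflSite q y), mq (Pi.single 0 _ + v)] at t3
    rw [mq (reflSite q y + v), mq (Pi.single 0 _ - v)] at t4
    rw [mq y, mq (y + v)]
    unfold curvDefect diagCov
    rw [mq (Pi.single 0 _), mq (Pi.single 0 _ + v), mq (Pi.single 0 _ - v)]
    linarith
  rw [e1, e2, e3] at key
  exact key

end Summit.QuantumFields.YangMills.Cruxes.UniversalDetectorHankel

end
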